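import Mathlib
import Literature.Analysis.FluidPDE.StationaryEulerAlignedCubes
import Literature.Analysis.FluidPDE.VectorCalculus
import Literature.Analysis.FluidPDE.SpaceTimeRescaling
import Literature.Analysis.FunctionSpaces.SobolevDomain
import HarnessLib

/-!
# Tools for the stub `stub_replicate` (crux `PointSink.PointFluxCone`,
# stmt-AnomalousDissipation-19033, line `Sketch`): dilation replication of a wild box

Elementary engine for replicating ONE bounded, compactly supported weak Euler pair `(W, P)` on
`ℝ³ = Ed (Fin 3)` (supported in the unit box `(0,1)³`, weak Euler with explicit pressure and weakly
divergence free against all smooth compactly supported tests) along the dilation orbit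
`y ↦ 8^j (x + c)`, `c = 3e₀`:

* geometry of the translated box `c + (0,1)³ ⊂ {3 < ‖y‖ < √18} ⊂ {1 < ‖y‖ < 8}` and the dilation
  selector `k(y) = ⌊log₈ ‖y‖⌋` (`replicate_floor_eq`: the `8^j`-copy can only be met where
  `k = j`; shift by one under `y ↦ 8y`; `k = 0` on the fundamental shell; measurability; finitely
  many values on the support of a test supported off the origin);
* scaling covariance of tested identities (`replicate_piece`: chain rule for `z ↦ x₁ + a z` and the
  affine change of variables `integral_comp_space_affine` of the tree), integrability of the
  rescaled pieces (bounded measurable times continuous compactly supported), the finite sum of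
  pieces, local integrability off the origin from annular bounds, and the annular bound of one
  rescaled copy.

All statements are folklore calculus / measure theory; the file ends with the registered tools
stub `stub_replicateTools` (conjunction of the helper statements).
-/

noncomputable section

open scoped InnerProductSpace ContDiff ENNReal Topology
open Set Function MeasureTheory Metric Filter
open Literature.Analysis.FluidPDE Literature.Analysis.FluidPDE.StationaryEuler
open Literature.Analysis.FunctionSpaces

set_option linter.dupNamespace false

namespace Summit.AnomalousDissipation.AnomalousDissipation.Theorems

/-- The translated unit box `c + (0,1)³`, `c = 3e₀`, lies in the shell `9 < ‖z‖² < 18`. [folklore] -/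
theorem replicate_norm_sq_of_mem_box {z : Ed (Fin 3)}
    (hz : -((3 : ℝ) • eb (0 : Fin 3)) + z ∈ box (Fin 3)) : 9 < ‖z‖ ^ 2 ∧ ‖z‖ ^ 2 < 18 := by
  rw [mem_box] at hz
  have h0 := hz 0
  have h1 := hz 1
  have h2 := hz 2
  simp only [PiLp.add_apply, PiLp.neg_apply, PiLp.smul_apply, PiLp.single_apply,
    smul_eq_mul, mem_Ioo, if_neg (show (1 : Fin 3) ≠ 0 by decide),
    if_neg (show (2 : Fin 3) ≠ 0 by decide)] at h0 h1 h2
  norm_num at h0 h1 h2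
  rw [EuclideanSpace.norm_sq_eq, Fin.sum_univ_three]
  simp only [Real.norm_eq_abs, sq_abs]
  constructor <;> nlinarith [h0.1, h0.2, h1.1, h1.2, h2.1, h2.2]

/-- **The translated box lies in the fundamental shell** `1 < ‖y‖ < 8`. [folklore] -/
theorem replicate_shell_of_mem_box {y : Ed (Fin 3)}
    (h : -((3 : ℝ) • eb (0 : Fin 3)) + y ∈ box (Fin 3)) : 1 < ‖y‖ ∧ ‖y‖ < 8 := by
  obtain ⟨h9, h18⟩ := replicate_norm_sq_of_mem_box h
  have := norm_nonneg y
  constructor <;> nlinarith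

/-- **The dilation selector.** If the `8^j`-dilated translated box contains `y`, then
`⌊log₈ ‖y‖⌋ = j` (the dilated shells `8^j · (3, √18)` are separated by the selector). [folklore] -/
theorem replicate_floor_eq {y : Ed (Fin 3)} {j : ℤ}
    (h : -((3 : ℝ) • eb (0 : Fin 3)) + ((8 : ℝ) ^ j)⁻¹ • y ∈ box (Fin 3)) :
    ⌊Real.logb 8 ‖y‖⌋ = j := by
  have h8 : (1 : ℝ) < 8 := by norm_num
  have ha : (0 : ℝ) < (8 : ℝ) ^ j := zpow_pos (by norm_num) j
  obtain ⟨h9, h18⟩ := replicate_norm_sq_of_mem_box h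
  rw [norm_smul, norm_inv, Real.norm_eq_abs, abs_of_pos ha] at h9 h18
  have ht0 : 0 ≤ ((8 : ℝ) ^ j)⁻¹ * ‖y‖ := by positivity
  have ht3 : 3 < ((8 : ℝ) ^ j)⁻¹ * ‖y‖ := by nlinarith
  have ht8 : ((8 : ℝ) ^ j)⁻¹ * ‖y‖ < 8 := by nlinarith
  have hy3 : 3 * (8 : ℝ) ^ j < ‖y‖ := by
    have := mul_lt_mul_of_pos_left ht3 ha
    rw [mul_inv_cancel_left₀ ha.ne'] at this
    linarith
  have hy8 : ‖y‖ < (8 : ℝ) ^ j * 8 := by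
    have := mul_lt_mul_of_pos_left ht8 ha
    rwa [mul_inv_cancel_left₀ ha.ne'] at this
  have hy0 : 0 < ‖y‖ := by nlinarith
  rw [Int.floor_eq_iff, Real.le_logb_iff_rpow_le h8 hy0, Real.logb_lt_iff_lt_rpow h8 hy0,
    Real.rpow_add (by norm_num : (0 : ℝ) < 8), Real.rpow_intCast, Real.rpow_one]
  exact ⟨by linarith, hy8⟩

/-- The selector shifts by one under the dilation `y ↦ 8y` (`y ≠ 0`). [folklore] -/
theorem replicate_floor_smul {y : Ed (Fin 3)} (hy : y ≠ 0) :
    ⌊Real.logb 8 ‖(8 : ℝ) • y‖⌋ = ⌊Real.logb 8 ‖y‖⌋ + 1 := by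
  rw [norm_smul, Real.norm_eq_abs, abs_of_pos (by norm_num : (0 : ℝ) < 8),
    Real.logb_mul (by norm_num) (norm_ne_zero_iff.2 hy), Real.logb_self_eq_one (by norm_num),
    add_comm, Int.floor_add_one]

/-- The selector vanishes on the fundamental shell `1 < ‖y‖ < 8`. [folklore] -/
theorem replicate_floor_shell {y : Ed (Fin 3)} (h1 : 1 < ‖y‖) (h8 : ‖y‖ < 8) :
    ⌊Real.logb 8 ‖y‖⌋ = 0 := by
  have hb : (1 : ℝ) < 8 := by norm_num
  have hy0 : 0 < ‖y‖ := by linarith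
  rw [Int.floor_eq_iff, Int.cast_zero, zero_add, Real.le_logb_iff_rpow_le hb hy0,
    Real.logb_lt_iff_lt_rpow hb hy0, Real.rpow_zero, Real.rpow_one]
  exact ⟨h1.le, h8⟩

/-- The selector `y ↦ ⌊log₈ ‖y‖⌋` is measurable. [folklore] -/
theorem replicate_measurable_floor : Measurable fun y : Ed (Fin 3) => ⌊Real.logb 8 ‖y‖⌋ :=
  Int.measurable_floor.comp ((Real.measurable_log.comp measurable_norm).div_const _)

/-- On the support of a test field supported off the origin the selector takes finitely many
values (the support lies in an annulus `r ≤ ‖y‖ ≤ R`, `r > 0`). [folklore] -/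
theorem replicate_exists_finset {F : Type*} [NormedAddCommGroup F] [NormedSpace ℝ F]
    {φ : Ed (Fin 3) → F} (hφ : IsTestFunctionOn ⟨{x : Ed (Fin 3) | x ≠ 0}, isOpen_ne⟩ φ) :
    ∃ S : Finset ℤ, ∀ y ∈ tsupport φ, ⌊Real.logb 8 ‖y‖⌋ ∈ S := by
  have hK : IsCompact (tsupport φ) := hφ.hasCompactSupport
  have h0 : (0 : Ed (Fin 3)) ∈ (tsupport φ)ᶜ := fun h => hφ.tsupport_subset h rfl
  obtain ⟨r, hr, hball⟩ := Metric.isOpen_iff.1 hK.isClosed.isOpen_compl 0 h0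
  obtain ⟨R, hR⟩ := hK.isBounded.subset_closedBall 0
  refine ⟨Finset.Icc ⌊Real.logb 8 r⌋ ⌊Real.logb 8 R⌋, fun y hy => ?_⟩
  have hry : r ≤ ‖y‖ := not_lt.1 fun h => hball (mem_ball_zero_iff.2 h) hy
  have hyR : ‖y‖ ≤ R := mem_closedBall_zero_iff.1 (hR hy)
  have h8 : (1 : ℝ) < 8 := by norm_num
  exact Finset.mem_Icc.2 ⟨Int.floor_le_floor (Real.logb_le_logb_of_le h8 hr hry),
    Int.floor_le_floor (Real.logb_le_logb_of_le h8 (hr.trans_le hry) hyR)⟩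

/-- **Chain rule** for the affine dilation `z ↦ x₁ + a z` (no differentiability needed: both sides
are junk `0` together). [folklore] -/
theorem replicate_fderiv_comp {F : Type*} [NormedAddCommGroup F] [NormedSpace ℝ F]
    (φ : Ed (Fin 3) → F) (a : ℝ) (x₁ x : Ed (Fin 3)) :
    fderiv ℝ (fun z => φ (x₁ + a • z)) x = a • fderiv ℝ φ (x₁ + a • x) := by
  -- adapted from Literature/Analysis/FluidPDE/SpaceTimeRescaling (fderiv_stPull)
  have h := fderiv_comp_smul (𝕜 := ℝ) (f := fun z => φ (x₁ + z)) (x := x) a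
  rw [fderiv_comp_add_left] at h
  exact h

/-- **One rescaled translated copy is again a weak solution** (scaling covariance). For a tested
identity `∫ Φ(Dψ(x), W(x), P(x)) dx = 0` holding for all smooth compactly supported `ψ`, with `Φ`
homogeneous of degree one in the derivative slot, the copy `x = c + a⁻¹ y` satisfies
`∫ Φ(Dφ(y), W(c + a⁻¹y), P(c + a⁻¹y)) dy = 0` for every smooth compactly supported `φ`: test the
hypothesis with `ψ(x) = φ(a(x - c))` (chain rule `Dψ(x) = a Dφ(a(x-c))`) and change variables
`y = a(x - c)`. [folklore] -/
theorem replicate_piece {F : Type*} [NormedAddCommGroup F] [NormedSpace ℝ F]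
    (Φ : (Ed (Fin 3) →L[ℝ] F) → Ed (Fin 3) → ℝ → ℝ)
    (hΦ : ∀ (t : ℝ) (L : Ed (Fin 3) →L[ℝ] F) (w : Ed (Fin 3)) (p : ℝ), Φ (t • L) w p = t * Φ L w p)
    (W : Ed (Fin 3) → Ed (Fin 3)) (P : Ed (Fin 3) → ℝ)
    (hWP : ∀ ψ : Ed (Fin 3) → F, ContDiff ℝ ∞ ψ → HasCompactSupport ψ →
      ∫ x, Φ (fderiv ℝ ψ x) (W x) (P x) = 0)
    {a : ℝ} (ha : 0 < a) (c : Ed (Fin 3)) {φ : Ed (Fin 3) → F} (hφ : ContDiff ℝ ∞ φ)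
    (hφc : HasCompactSupport φ) :
    ∫ y, Φ (fderiv ℝ φ y) (W (c + a⁻¹ • y)) (P (c + a⁻¹ • y)) = 0 := by
  have hT : ∀ y : Ed (Fin 3), -(a • c) + a • (c + a⁻¹ • y) = y := fun y => by
    rw [smul_add, smul_inv_smul₀ ha.ne', neg_add_cancel_left]
  have h0 := hWP (fun z => φ (-(a • c) + a • z))
    (hφ.comp (contDiff_const.add (contDiff_id.const_smul a)))
    (hφc.comp_homeomorph (spaceAffineHomeomorph ha.ne' (-(a • c))))
  simp_rw [replicate_fderiv_comp φ a (-(a • c)), hΦ] at h0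
  rw [integral_const_mul, mul_eq_zero] at h0
  have h1 := integral_comp_space_affine (inv_pos.2 ha) c
    (fun x => Φ (fderiv ℝ φ (-(a • c) + a • x)) (W x) (P x))
  simp only [hT] at h1
  rw [h1, h0.resolve_left ha.ne', smul_zero]

/-- The divergence of a smooth field is continuous. [folklore] -/
theorem replicate_continuous_div {φ : Ed (Fin 3) → Ed (Fin 3)} (hφ : ContDiff ℝ ∞ φ) :
    Continuous (VectorCalculus.divergence φ) := by
  have hD : Continuous (fderiv ℝ φ) := hφ.continuous_fderiv (by simp)
  have : VectorCalculus.divergence φ = fun x => ∑ i, ⟪(EuclideanSpace.basisFun (Fin 3) ℝ) i,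
      fderiv ℝ φ x ((EuclideanSpace.basisFun (Fin 3) ℝ) i)⟫_ℝ :=
    funext fun x => divergence_eq_sum_inner_fderiv _ φ x
  rw [this]
  exact continuous_finsetSum _ fun i _ => continuous_const.inner (hD.clm_apply continuous_const)

/-- The divergence of a smooth compactly supported field is integrable. [folklore] -/
theorem replicate_integrable_div {φ : Ed (Fin 3) → Ed (Fin 3)} (hφ : ContDiff ℝ ∞ φ)
    (hφc : HasCompactSupport φ) : Integrable (VectorCalculus.divergence φ) :=
  (replicate_continuous_div hφ).integrable_of_hasCompactSupport
    ((hφc.fderiv ℝ).comp_left (g := fun L : Ed (Fin 3) →L[ℝ] Ed (Fin 3) =>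
      LinearMap.trace ℝ _ (L : Ed (Fin 3) →ₗ[ℝ] Ed (Fin 3))) (by simp))

/-- **Integrability of a rescaled Euler piece**: for bounded measurable `W`, `P` and a smooth
compactly supported test field `φ`, `y ↦ ⟪W(Ty), Dφ(y) W(Ty)⟫ + P(Ty) div φ(y)` (`T` affine) is
integrable (bounded measurable times continuous compactly supported). [folklore] -/
theorem replicate_integrable_euler {W : Ed (Fin 3) → Ed (Fin 3)} {P : Ed (Fin 3) → ℝ} {M : ℝ}
    (hWm : Measurable W) (hPm : Measurable P) (hb : ∀ x, ‖W x‖ ≤ M ∧ |P x| ≤ M)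
    {φ : Ed (Fin 3) → Ed (Fin 3)} (hφ : ContDiff ℝ ∞ φ) (hφc : HasCompactSupport φ)
    (c : Ed (Fin 3)) (t : ℝ) :
    Integrable fun y => ⟪W (c + t • y), fderiv ℝ φ y (W (c + t • y))⟫_ℝ +
      P (c + t • y) * VectorCalculus.divergence φ y := by
  have hM : 0 ≤ M := (norm_nonneg _).trans (hb 0).1
  have hT : Measurable fun y : Ed (Fin 3) => c + t • y := (measurable_const_smul t).const_add c
  have hWT : Measurable fun y => W (c + t • y) := hWm.comp hT
  have hD : Continuous (fderiv ℝ φ) := hφ.continuous_fderiv (by simp)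
  refine Integrable.add ?_ ((replicate_integrable_div hφ hφc).bdd_mul (c := M)
    (hPm.comp hT).aestronglyMeasurable
    (ae_of_all _ fun y => by rw [Real.norm_eq_abs]; exact (hb _).2))
  have hg : Integrable fun y => M * (‖fderiv ℝ φ y‖ * M) :=
    ((hD.norm.mul_const M).const_mul M).integrable_of_hasCompactSupport
      (hφc.fderiv ℝ).norm.mul_right.mul_left
  have h2 : Measurable fun y => fderiv ℝ φ y (W (c + t • y)) :=
    Continuous.measurable2 (isBoundedBilinearMap_apply (𝕜 := ℝ) (E := Ed (Fin 3))
      (F := Ed (Fin 3))).continuous hD.measurable hWT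
  refine hg.mono' (hWT.inner h2).aestronglyMeasurable (ae_of_all _ fun y => ?_)
  rw [Real.norm_eq_abs]
  calc |⟪W (c + t • y), fderiv ℝ φ y (W (c + t • y))⟫_ℝ|
      ≤ ‖W (c + t • y)‖ * ‖fderiv ℝ φ y (W (c + t • y))‖ := abs_real_inner_le_norm _ _
    _ ≤ ‖W (c + t • y)‖ * (‖fderiv ℝ φ y‖ * ‖W (c + t • y)‖) :=
      mul_le_mul_of_nonneg_left (ContinuousLinearMap.le_opNorm _ _) (norm_nonneg _)
    _ ≤ M * (‖fderiv ℝ φ y‖ * M) :=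
      mul_le_mul (hb _).1 (mul_le_mul_of_nonneg_left (hb _).1 (norm_nonneg _))
        (by positivity) hM

/-- **Integrability of a rescaled divergence piece** `y ↦ Dθ(y) W(Ty)`. [folklore] -/
theorem replicate_integrable_grad {W : Ed (Fin 3) → Ed (Fin 3)} {M : ℝ} (hWm : Measurable W)
    (hbW : ∀ x, ‖W x‖ ≤ M) {θ : Ed (Fin 3) → ℝ} (hθ : ContDiff ℝ ∞ θ)
    (hθc : HasCompactSupport θ) (c : Ed (Fin 3)) (t : ℝ) :
    Integrable fun y => fderiv ℝ θ y (W (c + t • y)) := by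
  have hWT : Measurable fun y => W (c + t • y) :=
    hWm.comp ((measurable_const_smul t).const_add c)
  have hD : Continuous (fderiv ℝ θ) := hθ.continuous_fderiv (by simp)
  have hg : Integrable fun y => ‖fderiv ℝ θ y‖ * M :=
    (hD.norm.mul_const M).integrable_of_hasCompactSupport (hθc.fderiv ℝ).norm.mul_right
  refine hg.mono' (Continuous.measurable2 (isBoundedBilinearMap_apply (𝕜 := ℝ)
    (E := Ed (Fin 3)) (F := ℝ)).continuous hD.measurable hWT).aestronglyMeasurable
    (ae_of_all _ fun y => ?_)
  exact (ContinuousLinearMap.le_opNorm _ _).trans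
    (mul_le_mul_of_nonneg_left (hbW _) (norm_nonneg _))

/-- **Finite sum of pieces.** If `F(y) = G_{k(y)}(y)`, the pieces `G_j(y)` vanish for `j ≠ k(y)`
and `G_{k(y)}(y)` vanishes when `k(y) ∉ S`, then `F = Σ_{j ∈ S} G_j`; if moreover every piece is
integrable with integral zero, `∫ F = 0`. [folklore] -/
theorem replicate_integral_eq_zero_of_pieces (k : Ed (Fin 3) → ℤ) (S : Finset ℤ)
    (F : Ed (Fin 3) → ℝ) (G : ℤ → Ed (Fin 3) → ℝ) (hFG : ∀ y, F y = G (k y) y)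
    (hoff : ∀ y j, j ≠ k y → G j y = 0) (hout : ∀ y, k y ∉ S → G (k y) y = 0)
    (hint : ∀ j, Integrable (G j)) (hzero : ∀ j, ∫ y, G j y = 0) : ∫ y, F y = 0 := by
  have : F = fun y => ∑ j ∈ S, G j y := funext fun y => by
    rw [hFG, Finset.sum_eq_single (k y) (fun j _ hj => hoff y j hj) (hout y)]
  rw [this, integral_finsetSum S fun j _ => hint j]
  exact Finset.sum_eq_zero fun j _ => hzero j

/-- **Local integrability off the origin from annular bounds**: a strongly measurable function
bounded on every exterior region `r ≤ ‖y‖`, `r > 0`, is locally integrable on `{y ≠ 0}` (a compact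
subset of `{y ≠ 0}` keeps a positive distance from `0` and has finite measure). [folklore] -/
theorem replicate_locallyIntegrableOn {f : Ed (Fin 3) → ℝ} (hf : AEStronglyMeasurable f volume)
    (hb : ∀ r : ℝ, 0 < r → ∃ B : ℝ, ∀ y, r ≤ ‖y‖ → ‖f y‖ ≤ B) :
    LocallyIntegrableOn f {y | y ≠ 0} volume := by
  rw [locallyIntegrableOn_iff isOpen_ne.isLocallyClosed]
  intro K hK hKc
  have h0 : (0 : Ed (Fin 3)) ∈ Kᶜ := fun h => hK h rfl
  obtain ⟨r, hr, hball⟩ := Metric.isOpen_iff.1 hKc.isClosed.isOpen_compl 0 h0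
  obtain ⟨B, hB⟩ := hb r hr
  refine Measure.integrableOn_of_bounded hKc.measure_lt_top.ne hf (M := B) ?_
  rw [ae_restrict_iff' hKc.measurableSet]
  exact ae_of_all _ fun y hy => hB y (not_lt.1 fun h => hball (mem_ball_zero_iff.2 h) hy)

/-- **Annular bound of one rescaled copy**: if `‖F‖ ≤ M` and `F` vanishes off the unit box, then for
`s ≤ 0`, `a > 0` and `‖y‖ ≥ r > 0`, `‖a^s F(-c + a⁻¹y)‖ ≤ (r/8)^s M` (a non-zero value forces
`-c + a⁻¹ y ∈ box`, whence `‖y‖ < 8a`). [folklore] -/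
theorem replicate_norm_piece_le {G : Type*} [NormedAddCommGroup G] [NormedSpace ℝ G]
    {F : Ed (Fin 3) → G} {M : ℝ} (hbF : ∀ x, ‖F x‖ ≤ M)
    (hS : ∀ x, x ∉ box (Fin 3) → F x = 0) {s : ℝ} (hs : s ≤ 0) {r : ℝ} (hr : 0 < r)
    {a : ℝ} (ha : 0 < a) {y : Ed (Fin 3)} (hy : r ≤ ‖y‖) :
    ‖a ^ s • F (-((3 : ℝ) • eb (0 : Fin 3)) + a⁻¹ • y)‖ ≤ (r / 8) ^ s * M := by
  have hM : 0 ≤ M := (norm_nonneg _).trans (hbF 0)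
  by_cases h0 : F (-((3 : ℝ) • eb (0 : Fin 3)) + a⁻¹ • y) = 0
  · rw [h0, smul_zero, norm_zero]
    exact mul_nonneg (Real.rpow_nonneg (by positivity) s) hM
  obtain ⟨-, h18⟩ := replicate_norm_sq_of_mem_box (not_imp_comm.1 (hS _) h0)
  rw [norm_smul, norm_inv, Real.norm_eq_abs, abs_of_pos ha] at h18
  have ht0 : 0 ≤ a⁻¹ * ‖y‖ := by positivity
  have ht8 : a⁻¹ * ‖y‖ < 8 := by nlinarith
  have hy8 : ‖y‖ < a * 8 := by
    have := mul_lt_mul_of_pos_left ht8 ha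
    rwa [mul_inv_cancel_left₀ ha.ne'] at this
  have hra : r / 8 ≤ a := by rw [div_le_iff₀ (by norm_num : (0:ℝ) < 8)]; linarith
  rw [norm_smul, Real.norm_eq_abs, abs_of_pos (Real.rpow_pos_of_pos ha s)]
  exact mul_le_mul (Real.rpow_le_rpow_of_nonpos (by positivity) hra hs) (hbF _) (norm_nonneg _)
    (Real.rpow_nonneg (by positivity) s)

/-- `⟪w, ∇θ(y)⟫ = Dθ(y) w` (Riesz representation of the gradient). [folklore] -/
theorem replicate_inner_gradient (θ : Ed (Fin 3) → ℝ) (w y : Ed (Fin 3)) :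
    ⟪w, gradient θ y⟫_ℝ = fderiv ℝ θ y w := by
  rw [real_inner_comm, gradient, InnerProductSpace.toDual_symm_apply]

/-- Registered tools stub of `stub_replicate` (line `Sketch` of crux `PointSink.PointFluxCone`):
the conjunction of the helper statements of this file. [folklore] -/
theorem stub_replicateTools :
    (∀ z : Ed (Fin 3), -((3 : ℝ) • eb (0 : Fin 3)) + z ∈ box (Fin 3) → 9 < ‖z‖ ^ 2 ∧ ‖z‖ ^ 2 < 18) ∧
    (∀ y : Ed (Fin 3), -((3 : ℝ) • eb (0 : Fin 3)) + y ∈ box (Fin 3) → 1 < ‖y‖ ∧ ‖y‖ < 8) ∧ (∀ (y :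
    Ed (Fin 3)) (j : ℤ), -((3 : ℝ) • eb (0 : Fin 3)) + ((8 : ℝ) ^ j)⁻¹ • y ∈ box (Fin 3) →
    ⌊Real.logb 8 ‖y‖⌋ = j) ∧ (∀ y : Ed (Fin 3), y ≠ 0 → ⌊Real.logb 8 ‖(8 : ℝ) • y‖⌋ = ⌊Real.logb 8
    ‖y‖⌋ + 1) ∧ (∀ y : Ed (Fin 3), 1 < ‖y‖ → ‖y‖ < 8 → ⌊Real.logb 8 ‖y‖⌋ = 0) ∧ (Measurable fun y :
    Ed (Fin 3) => ⌊Real.logb 8 ‖y‖⌋) ∧ (∀ φ : Ed (Fin 3) → Ed (Fin 3), IsTestFunctionOn ⟨{x : Ed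
    (Fin 3) | x ≠ 0}, isOpen_ne⟩ φ → ∃ S : Finset ℤ, ∀ y ∈ tsupport φ, ⌊Real.logb 8 ‖y‖⌋ ∈ S) ∧ (∀
    (φ : Ed (Fin 3) → Ed (Fin 3)) (a : ℝ) (x₁ x : Ed (Fin 3)), fderiv ℝ (fun z => φ (x₁ + a • z)) x
    = a • fderiv ℝ φ (x₁ + a • x)) ∧ (∀ (Φ : (Ed (Fin 3) →L[ℝ] Ed (Fin 3)) → Ed (Fin 3) → ℝ → ℝ), (∀
    (t : ℝ) (L : Ed (Fin 3) →L[ℝ] Ed (Fin 3)) (w : Ed (Fin 3)) (p : ℝ), Φ (t • L) w p = t * Φ L w p)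
    → ∀ (W : Ed (Fin 3) → Ed (Fin 3)) (P : Ed (Fin 3) → ℝ), (∀ ψ : Ed (Fin 3) → Ed (Fin 3), ContDiff
    ℝ ∞ ψ → HasCompactSupport ψ → ∫ x, Φ (fderiv ℝ ψ x) (W x) (P x) = 0) → ∀ a : ℝ, 0 < a → ∀ (c :
    Ed (Fin 3)) (φ : Ed (Fin 3) → Ed (Fin 3)), ContDiff ℝ ∞ φ → HasCompactSupport φ → ∫ y, Φ (fderiv
    ℝ φ y) (W (c + a⁻¹ • y)) (P (c + a⁻¹ • y)) = 0) ∧ (∀ φ : Ed (Fin 3) → Ed (Fin 3), ContDiff ℝ ∞ φ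
    → Continuous (VectorCalculus.divergence φ)) ∧ (∀ φ : Ed (Fin 3) → Ed (Fin 3), ContDiff ℝ ∞ φ →
    HasCompactSupport φ → Integrable (VectorCalculus.divergence φ)) ∧ (∀ (W : Ed (Fin 3) → Ed (Fin
    3)) (P : Ed (Fin 3) → ℝ) (M : ℝ), Measurable W → Measurable P → (∀ x, ‖W x‖ ≤ M ∧ |P x| ≤ M) → ∀
    φ : Ed (Fin 3) → Ed (Fin 3), ContDiff ℝ ∞ φ → HasCompactSupport φ → ∀ (c : Ed (Fin 3)) (t : ℝ),
    Integrable fun y => ⟪W (c + t • y), fderiv ℝ φ y (W (c + t • y))⟫_ℝ + P (c + t • y) *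
    VectorCalculus.divergence φ y) ∧ (∀ (W : Ed (Fin 3) → Ed (Fin 3)) (M : ℝ), Measurable W → (∀ x,
    ‖W x‖ ≤ M) → ∀ θ : Ed (Fin 3) → ℝ, ContDiff ℝ ∞ θ → HasCompactSupport θ → ∀ (c : Ed (Fin 3)) (t
    : ℝ), Integrable fun y => fderiv ℝ θ y (W (c + t • y))) ∧ (∀ (k : Ed (Fin 3) → ℤ) (S : Finset ℤ)
    (F : Ed (Fin 3) → ℝ) (G : ℤ → Ed (Fin 3) → ℝ), (∀ y, F y = G (k y) y) → (∀ y j, j ≠ k y → G j y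
    = 0) → (∀ y, k y ∉ S → G (k y) y = 0) → (∀ j, Integrable (G j)) → (∀ j, ∫ y, G j y = 0) → ∫ y, F
    y = 0) ∧ (∀ f : Ed (Fin 3) → ℝ, AEStronglyMeasurable f volume → (∀ r : ℝ, 0 < r → ∃ B : ℝ, ∀ y,
    r ≤ ‖y‖ → ‖f y‖ ≤ B) → LocallyIntegrableOn f {y | y ≠ 0} volume) ∧ (∀ (F : Ed (Fin 3) → Ed (Fin
    3)) (M : ℝ), (∀ x, ‖F x‖ ≤ M) → (∀ x, x ∉ box (Fin 3) → F x = 0) → ∀ s : ℝ, s ≤ 0 → ∀ r : ℝ, 0 <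
    r → ∀ a : ℝ, 0 < a → ∀ y : Ed (Fin 3), r ≤ ‖y‖ → ‖a ^ s • F (-((3 : ℝ) • eb (0 : Fin 3)) + a⁻¹ •
    y)‖ ≤ (r / 8) ^ s * M) ∧ (∀ (θ : Ed (Fin 3) → ℝ) (w y : Ed (Fin 3)), ⟪w, gradient θ y⟫_ℝ =
    fderiv ℝ θ y w) :=
  ⟨fun _ h => replicate_norm_sq_of_mem_box h, fun _ h => replicate_shell_of_mem_box h,
    fun _ _ h => replicate_floor_eq h, fun _ hy => replicate_floor_smul hy,
    fun _ h1 h8 => replicate_floor_shell h1 h8, replicate_measurable_floor,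
    fun _ hφ => replicate_exists_finset hφ, replicate_fderiv_comp,
    fun Φ hΦ W P hWP _ ha c _ hφ hφc => replicate_piece Φ hΦ W P hWP ha c hφ hφc,
    fun _ h => replicate_continuous_div h, fun _ h hc => replicate_integrable_div h hc,
    fun _ _ _ hW hP hb _ hφ hφc c t => replicate_integrable_euler hW hP hb hφ hφc c t,
    fun _ _ hW hbW _ hθ hθc c t => replicate_integrable_grad hW hbW hθ hθc c t,
    replicate_integral_eq_zero_of_pieces, fun _ hf hb => replicate_locallyIntegrableOn hf hb,
    fun _ _ hbF hS _ hs _ hr _ ha _ hy => replicate_norm_piece_le hbF hS hs hr ha hy,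
    replicate_inner_gradient⟩

end Summit.AnomalousDissipation.AnomalousDissipation.Theorems

end
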